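import Summits.ResolutionOfSingularities.ResolutionOfSingularities.Theorems.DeepCrossCutClasses2
import HarnessLib

/-!
# DeepCrossCutCells — decomp-res node «DeepCrossCut» (lens-2 g22 rev8)

Content VERBATIM from the decomp-res lens-2 g22 node `HOME/decomp-res-lens-2/g22/DeepCrossCut.lean` rev8 (pin
8b8ca19c, 5 810 l; HOME = run/shared/lean/pub/decomp-res); CRITIC-LEDGER row 180 CLEARED ((X**) `DeepCrossExit`
DECIDED-MOD-PORT(M+) +1, MAP +1 (b′) fan game; rev8 = rev7 + the ONE residue-characteristic-2 GUARD of row 175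
(d″)(α′)); landing orders row 180 / critic INBOX :875: l. 143–4449 of the lens file are the earlier lens-2 nodes
RESTATED VERBATIM-IN-BODY (landed as `PurityCut*`, `SplitCut*`, `CylinderCut*`, `SpreadCut*`, `CrossCut*`,
`MaxContactCut{PurityCut,SplitCut,CylinderCut,SpreadCut,CrossCut}`) and are NOT restated here — the landed modules
are imported and opened instead; §Y.0 (ring level) + the inhabitant kernels landed earlier from g21 as
`DeepCrossCutKernels`, `…2`, `…3` (+ `DeepCrossCutKernelsCross`, the four cross-weight comparisons); THIS chain is
the NEW scheme layer §Y.2 + §Y.4–§Y.7 only, namespace `…Theses.DeepCrossCut` ↦ `…Theorems.DeepCrossCut`, split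
cone-free (`DeepCrossCutClasses*`, `DeepCrossCutCells*`) / Theses-cone (`MaxContactCutDeepCrossCut*`), files ≤ 400
lines, `--supports stmt-ResolutionOfSingularities-29273` (`MaxContactCut.RungOne`).  Column bookkeeping (row 180):
ONE aside SWITCH on the lens-2 column to `Deep.DeepSpecialRung` (home `DeepCrossCutCells*`), SUPERSEDING rev 50's
aside 33866 `MaxContactCut.LeafSpecialRung` via the exact re-locations.

§Y.4–§Y.7 cone-free part: §Y.4 the DEEP leaf `deepLeaf = crossLeaf ∨ (X**) ∨ (N)` and the located residual point
class `IsDeepSpecialPt` (= cross-special ∧ ¬ deep-cross (GUARDED) ∧ ¬ node); §Y.5–§Y.7 `namespace Deep`: the graded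
statements, the rungs **`DeepGenericRung`** (DECIDED half modulo ports / paper engines) / **`DeepSpecialRung`** (THE
LOCATED RESIDUAL of the lens-2 column after g22 — the ONE aside, SUPERSEDING the cross / spread / cylinder residuals
by the exact re-locations), kernels instantiated from §G, hypothesis-free links — this module chain is the cone-free
aside home (continued `…2` where the cap cuts).  The cut BY NAME on the route is in `MaxContactCutDeepCrossCut`.

(Sources: Hironaka1964 Ch. III; CossartJannsenSaito2020 Ch. 2, Ch. 8–9; CossartPiltant2008 Prop. 4.2;
CossartPiltant2019 Rem. 3.2; BierstoneGrigorievMilmanWlodarczyk2011 §3.1; Moh1987; Hauser2010Kangaroo; Giraud1975;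
Narasimhan1983; DershowitzManna1979.)
-/

open CategoryTheory AlgebraicGeometry TopologicalSpace IsLocalRing
open Literature.AlgebraicGeometry.Resolution
open Summit.ResolutionOfSingularities.ResolutionOfSingularities.Theorems
open Summit.ResolutionOfSingularities.ResolutionOfSingularities.Theorems.WeakOrderReduction
open Summit.ResolutionOfSingularities.ResolutionOfSingularities.Theorems.DeltaFaceCutClasses
open Summit.ResolutionOfSingularities.ResolutionOfSingularities.Theorems.RelativeDeltaCut
open Summit.ResolutionOfSingularities.ResolutionOfSingularities.Theorems.CurveLeafExit
open Summit.ResolutionOfSingularities.ResolutionOfSingularities.Theorems.PinchCut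
open Summit.ResolutionOfSingularities.ResolutionOfSingularities.Theorems.JetCut
open Summit.ResolutionOfSingularities.ResolutionOfSingularities.Theorems.PurityCut
open Summit.ResolutionOfSingularities.ResolutionOfSingularities.Theorems.SplitCut
open Summit.ResolutionOfSingularities.ResolutionOfSingularities.Theorems.CylinderCut
open Summit.ResolutionOfSingularities.ResolutionOfSingularities.Theorems.SpreadCut
open Summit.ResolutionOfSingularities.ResolutionOfSingularities.Theorems.CrossCut
open MvPolynomial

namespace Summit.ResolutionOfSingularities.ResolutionOfSingularities.Theorems.DeepCrossCut

/-! ## §Y.4  NEW (g21): the DEEP cut — the leaf `deepLeaf = crossLeaf ∨ (X**) ∨ (N)`, its located residual class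
`IsDeepSpecialPt`, the
rungs (instances of §G over g20's COMPONENT port), `Deep.closes` BY NAME, the engines at work, and the EXACT
RE-LOCATION of g20's
`Cross.CrossSpecialRung` (and of every earlier residual of the lineage and of the tree aside
`MaxContactCut.LeafSpecialRung`) modulo the
deep decided half — all 0 sorry. -/

/-- The DEEP leaf of g21: cross leaf (g20) ∨ deep-cross point ∨ nodal point.  DEFINITION (leaf instance). [folklore] -/
def deepLeaf : ∀ ⦃Y : Scheme.{0}⦄, Y.IdealSheafData → ℕ → Y → Prop :=
  fun _ I n y => crossLeaf I n y ∨ (IsDeepCrossPt I n y ∨ IsNodePt I n y)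

/-- `crossLeaf_le_deepLeaf`: Auxiliary step of this node's calculus, VERBATIM from the lens file (see the module
docstring); the statement is its type. [folklore] -/
theorem crossLeaf_le_deepLeaf ⦃Y : Scheme.{0}⦄ (I : Y.IdealSheafData) (n : ℕ) (y : Y) :
    crossLeaf I n y → deepLeaf I n y :=
  fun h => Or.inl h

/-- `spreadLeaf_le_deepLeaf`: Auxiliary step of this node's calculus, VERBATIM from the lens file (see the module
docstring); the statement is its type. [folklore] -/
theorem spreadLeaf_le_deepLeaf ⦃Y : Scheme.{0}⦄ (I : Y.IdealSheafData) (n : ℕ) (y : Y) :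
    spreadLeaf I n y → deepLeaf I n y :=
  fun h => Or.inl (spreadLeaf_le_crossLeaf I n y h)

/-- `cylLeaf_le_deepLeaf`: Auxiliary step of this node's calculus, VERBATIM from the lens file (see the module
docstring); the statement is its type. [folklore] -/
theorem cylLeaf_le_deepLeaf ⦃Y : Scheme.{0}⦄ (I : Y.IdealSheafData) (n : ℕ) (y : Y) :
    cylLeaf I n y → deepLeaf I n y :=
  fun h => Or.inl (cylLeaf_le_crossLeaf I n y h)

/-- `splitLeaf_le_deepLeaf`: Auxiliary step of this node's calculus, VERBATIM from the lens file (see the module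
docstring); the statement is its type. [folklore] -/
theorem splitLeaf_le_deepLeaf ⦃Y : Scheme.{0}⦄ (I : Y.IdealSheafData) (n : ℕ) (y : Y) :
    splitLeaf I n y → deepLeaf I n y :=
  fun h => Or.inl (splitLeaf_le_crossLeaf I n y h)

/-- `grandLeaf_le_deepLeaf`: Auxiliary step of this node's calculus, VERBATIM from the lens file (see the module
docstring); the statement is its type. [folklore] -/
theorem grandLeaf_le_deepLeaf ⦃Y : Scheme.{0}⦄ (I : Y.IdealSheafData) (n : ℕ) (y : Y) :
    grandLeaf I n y → deepLeaf I n y :=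
  fun h => Or.inl (grandLeaf_le_crossLeaf I n y h)

/-- `vastLeaf_le_deepLeaf`: Auxiliary step of this node's calculus, VERBATIM from the lens file (see the module
docstring); the statement is its type. [folklore] -/
theorem vastLeaf_le_deepLeaf ⦃Y : Scheme.{0}⦄ (I : Y.IdealSheafData) (n : ℕ) (y : Y) :
    vastLeaf I n y → deepLeaf I n y :=
  fun h => Or.inl (vastLeaf_le_crossLeaf I n y h)

/-- `pinchLeaf_le_deepLeaf`: Auxiliary step of this node's calculus, VERBATIM from the lens file (see the module
docstring); the statement is its type. [folklore] -/
theorem pinchLeaf_le_deepLeaf ⦃Y : Scheme.{0}⦄ (I : Y.IdealSheafData) (n : ℕ) (y : Y) :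
    pinchLeaf I n y → deepLeaf I n y :=
  fun h => Or.inl (pinchLeaf_le_crossLeaf I n y h)

/-- `deepLeaf_of_isDeepCrossPt`: Auxiliary step of this node's calculus, VERBATIM from the lens file (see the module
docstring); the statement is its type. [folklore] -/
theorem deepLeaf_of_isDeepCrossPt ⦃Y : Scheme.{0}⦄ {I : Y.IdealSheafData} {n : ℕ} {y : Y}
    (h : IsDeepCrossPt I n y) : deepLeaf I n y :=
  Or.inr (Or.inl h)

/-- `deepLeaf_of_isNodePt`: Auxiliary step of this node's calculus, VERBATIM from the lens file (see the module
docstring); the statement is its type. [folklore] -/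
theorem deepLeaf_of_isNodePt ⦃Y : Scheme.{0}⦄ {I : Y.IdealSheafData} {n : ℕ} {y : Y}
    (h : IsNodePt I n y) : deepLeaf I n y :=
  Or.inr (Or.inr h)

/-- `deepLeaf_of_isCrossPt`: Auxiliary step of this node's calculus, VERBATIM from the lens file (see the module
docstring); the statement is its type. [folklore] -/
theorem deepLeaf_of_isCrossPt ⦃Y : Scheme.{0}⦄ {I : Y.IdealSheafData} {n : ℕ} {y : Y}
    (h : IsCrossPt I n y) : deepLeaf I n y :=
  Or.inl (crossLeaf_of_isCrossPt h)

/-- **DEEP-SPECIAL point** [g21] — THE LOCATED RESIDUAL CLASS of this node: cross-special (g20) and NEITHER a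
deep-cross point NOR a nodal
point.  What is LEFT (booked, NODE-g21 §7): cuspidal secondary curves (INSEP-v³, E**), crosses / nodes at marking `n
≥ 3`, EVEN flat
depths, tangential or singular branches at the tangle, three or more branches, top surfaces through the core, `m ≢
−1 (mod n)`, mixed faces,
NON-PRINCIPAL `I_y` beyond the letters, Sing / Iso.  DEFINITION (NEW class). [folklore] -/
def IsDeepSpecialPt {k : Type} [Field k] {Y : Scheme.{0}} (g : Y ⟶ Spec (.of k)) (hY : Scheme.IsRegular Y)
    (I : Y.IdealSheafData) (n : ℕ) (y : Y) : Prop :=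
  IsCrossSpecialPt g hY I n y ∧ ¬ IsDeepCrossPt I n y ∧ ¬ IsNodePt I n y

/-- Pointwise: the deep-special class IS the `deepLeaf`-special class of §G.  KERNEL (PROVED). [folklore] -/
theorem isSpecPt_deepLeaf_iff {k : Type} [Field k] {Y : Scheme.{0}} (g : Y ⟶ Spec (.of k)) (hY : Scheme.IsRegular Y)
    (I : Y.IdealSheafData) (n : ℕ) (y : Y) : Leaf.IsSpecPt deepLeaf g hY I n y ↔ IsDeepSpecialPt g hY I n y := by
  constructor
  · rintro ⟨hL, hno⟩
    refine ⟨(isSpecPt_crossLeaf_iff g hY I n y).mp ⟨hL, fun h => hno (Or.inl h)⟩, fun h => hno (Or.inr (Or.inl h)),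
      fun h => hno (Or.inr (Or.inr h))⟩
  · rintro ⟨hS, hD, hN⟩
    obtain ⟨hL, hno⟩ := (isSpecPt_crossLeaf_iff g hY I n y).mpr hS
    refine ⟨hL, ?_⟩
    rintro (h | h | h)
    · exact hno h
    · exact hD h
    · exact hN h

/-- The deep-special class is contained in g20's cross-special class (the residual SHRINKS by letter).  KERNEL
(PROVED). [folklore] -/
theorem isCrossSpecialPt_of_isDeepSpecialPt {k : Type} [Field k] {Y : Scheme.{0}} {g : Y ⟶ Spec (.of k)}
    {hY : Scheme.IsRegular Y} {I : Y.IdealSheafData} {n : ℕ} {y : Y} (h : IsDeepSpecialPt g hY I n y) :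
    IsCrossSpecialPt g hY I n y :=
  h.1

/-- … and hence in g19's spread-special class.  KERNEL (PROVED). [folklore] -/
theorem isSpreadSpecialPt_of_isDeepSpecialPt {k : Type} [Field k] {Y : Scheme.{0}} {g : Y ⟶ Spec (.of k)}
    {hY : Scheme.IsRegular Y} {I : Y.IdealSheafData} {n : ℕ} {y : Y} (h : IsDeepSpecialPt g hY I n y) :
    IsSpreadSpecialPt g hY I n y :=
  h.1.1

/-- **EXACT POINTWISE DICHOTOMY of g20's residual class** (the structural dichotomy at a point, g21): cross-special
⟺ (cross-special and a
deep-cross or nodal point — the TWO-BRANCH side of arbitrary flat depth / the node, engine side) ∨ deep-special.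
KERNEL (PROVED). [folklore] -/
theorem isCrossSpecialPt_iff {k : Type} [Field k] {Y : Scheme.{0}} (g : Y ⟶ Spec (.of k)) (hY : Scheme.IsRegular Y)
    (I : Y.IdealSheafData) (n : ℕ) (y : Y) :
    IsCrossSpecialPt g hY I n y ↔
      (IsCrossSpecialPt g hY I n y ∧ (IsDeepCrossPt I n y ∨ IsNodePt I n y)) ∨ IsDeepSpecialPt g hY I n y := by
  constructor
  · intro h
    by_cases hd : IsDeepCrossPt I n y
    · exact Or.inl ⟨h, Or.inl hd⟩
    · by_cases hN : IsNodePt I n y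
      · exact Or.inl ⟨h, Or.inr hN⟩
      · exact Or.inr ⟨h, hd, hN⟩
  · rintro (⟨h, _⟩ | ⟨h, _⟩) <;> exact h

/-- At markings `n ≠ 2` the deep-special class IS the cross-special class (both new letters are marking-`2`
letters).  KERNEL (PROVED). [folklore] -/
theorem isDeepSpecialPt_iff_of_ne_two {k : Type} [Field k] {Y : Scheme.{0}} (g : Y ⟶ Spec (.of k)) (hY : Scheme.IsRegular Y)
    (I : Y.IdealSheafData) {n : ℕ} (hn : n ≠ 2) (y : Y) :
    IsDeepSpecialPt g hY I n y ↔ IsCrossSpecialPt g hY I n y :=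
  ⟨fun h => h.1, fun h => ⟨h, fun hc => hn (eq_two_of_isDeepCrossPt hc), fun hc => hn (eq_two_of_isNodePt hc)⟩⟩

namespace Deep

/-! ### §Y.5  The graded statements of the DEEP cut (instances of §G with the deep leaf) -/

/-- **`SeqDeepGen n`** — weak order reduction in dimension four at marking `n` for data ALL of whose top points are
in the decided classes
of g20, DEEP-CROSS points or NODAL points.  [DECIDED-MOD-PORT and MOD-(X**): `deepGenRungAt_of_engines`.]  STATEMENT SCHEMA
(= `Leaf.SeqGen deepLeaf n`). (Sources: BierstoneGrigorievMilmanWlodarczyk2011 §3.1; CossartPiltant2008 Prop. 4.2;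
Hironaka1967.) -/
def SeqDeepGen (n : ℕ) : Prop := Leaf.SeqGen deepLeaf n

/-- **`SeqDeepSpec n`** — THE LOCATED CLASS: weak order reduction at marking `n` for data having a DEEP-SPECIAL core top point.
[UNDECIDED · IDEA-NEEDED.]  STATEMENT SCHEMA (= `Leaf.SeqSpec deepLeaf n`). (Sources: CossartPiltant2019 Rem. 3.2; Moh1987.) -/
def SeqDeepSpec (n : ℕ) : Prop := Leaf.SeqSpec deepLeaf n

/-- `DeepGenRungAt n` — the decided rung at one marking. -/
def DeepGenRungAt (n : ℕ) : Prop := SeqDimFour 2 n → SeqDeepGen n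

/-- **`DeepGenericRung`** — the DECIDED-MOD-ENGINES half of `RungOne` (29273) for the deep leaf.  [WEAKER ·
DECIDED-MOD-PORT(M+)·MOD-(X**):
`deepGenericRung_of_ports`.]  STATEMENT (decided piece). (Sources: Hironaka1967; CossartPiltant2008 Prop. 4.2;
CossartJannsenSaito2020.) -/
def DeepGenericRung : Prop := E 2 → ∀ n : ℕ, 1 ≤ n → SeqDeepGen n

/-- **`DeepSpecialRung`** — THE LOCATED RESIDUAL of this node: `E 2 →` weak order reduction for every marking and
all data with a
deep-special core top point.  [WEAKER BY LETTER than `Cross.CrossSpecialRung` · UNDECIDED · IDEA-NEEDED · cofinal ⇒ score 0.]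
STATEMENT (located residual). (Sources: CossartPiltant2019 Rem. 3.2; Moh1987; Giraud1975; Narasimhan1983.) -/
def DeepSpecialRung : Prop := E 2 → ∀ n : ℕ, 1 ≤ n → SeqDeepSpec n

/-- `deepGenericRung_iff`: Auxiliary step of this node's calculus, VERBATIM from the lens file (see the module
docstring); the statement is its type. [folklore] -/
theorem deepGenericRung_iff : DeepGenericRung ↔ Leaf.GenericRung deepLeaf := Iff.rfl

/-- `deepSpecialRung_iff`: Auxiliary step of this node's calculus, VERBATIM from the lens file (see the module
docstring); the statement is its type. [folklore] -/
theorem deepSpecialRung_iff : DeepSpecialRung ↔ Leaf.SpecialRung deepLeaf := Iff.rfl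

section Kernels

variable {n : ℕ}

/-! ### §Y.6  Kernels of the DEEP cut (instantiated from §G; 0 sorry) -/

/-- **EXACT at each marking**: `SeqDimFour 1 n ⟺ SeqDeepGen n ∧ SeqDeepSpec n`. [folklore] -/
theorem seqDimFour_one_iff : SeqDimFour 1 n ↔ SeqDeepGen n ∧ SeqDeepSpec n :=
  Leaf.seqDimFour_one_iff (L := deepLeaf)

/-- Under the engines (M) (C) (G) (S) (Cyl) (JCyl) (Γ) (X) and the NEW (X**) (N) every point of the deep leaf is a
curve-exit point or a
component-exit point. [folklore] -/
theorem isExitPt_of_deepLeaf (hM : MonomialPinchExit) (hC : FlatConeExit) (hGE : GrandExit) (hSE : SplitConeExit)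
    (hCE : CylinderExit) (hJE : JetCylinderExit) (hΓE : SpreadExit) (hXE : CrossExit) (hDXE : DeepCrossExit) (hNE : NodeExit)
    (hn : 2 ≤ n) ⦃Y : Scheme.{0}⦄ (hY : Scheme.IsRegular Y) ⦃I : Y.IdealSheafData⦄ ⦃y : Y⦄ (h : deepLeaf I n y) :
    IsCurveExitPt I n y ∨ IsComponentExitPt I n y := by
  rcases h with h | h | h
  · exact Cross.isExitPt_of_crossLeaf hM hC hGE hSE hCE hJE hΓE hXE hn hY h
  · exact Or.inr (isComponentExitPt_of_isDeepCrossPt hDXE hY h)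
  · exact Or.inr (isComponentExitPt_of_isNodePt hNE hY h)

/-- **THE ENGINES AT WORK**: the five tree engines, (M) (C) (G) (S) (Cyl) (JCyl) (Γ) (X), the NEW (X**) (N) and the
COMPONENT port give
`DeepGenRungAt n` for `n ≥ 2`. [folklore] -/
theorem deepGenRungAt_of_engines (hV : VeryNearCutClasses.VeryNearExit) (hD : DeltaPackageExit)
    (hU : UniformCurvePackageExit) (hR : RelCurvePackageExit) (hN : NormalConeJumpExit)
    (hM : MonomialPinchExit) (hC : FlatConeExit) (hGE : GrandExit) (hSE : SplitConeExit)
    (hCE : CylinderExit) (hJE : JetCylinderExit) (hΓE : SpreadExit) (hXE : CrossExit) (hDXE : DeepCrossExit) (hNE : NodeExit)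
    (hP : ComponentPackagePort n) (hn : 2 ≤ n) : DeepGenRungAt n :=
  Leaf.genRungAt_of_componentPort (L := deepLeaf) hV hD hU hR hN
    (isExitPt_of_deepLeaf hM hC hGE hSE hCE hJE hΓE hXE hDXE hNE hn) hP hn

/-- **`DeepGenericRung` is DECIDED modulo the typed pieces**: engines (as hypotheses; (X**) among them DECIDED on
paper, kernel port open), the component
port at every marking `≥ 2`, the order-one contact port. [folklore] -/
theorem deepGenericRung_of_engines (hV : VeryNearCutClasses.VeryNearExit) (hD : DeltaPackageExit)
    (hU : UniformCurvePackageExit) (hR : RelCurvePackageExit) (hN : NormalConeJumpExit)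
    (hM : MonomialPinchExit) (hC : FlatConeExit) (hGE : GrandExit) (hSE : SplitConeExit)
    (hCE : CylinderExit) (hJE : JetCylinderExit) (hΓE : SpreadExit) (hXE : CrossExit) (hDXE : DeepCrossExit) (hNE : NodeExit)
    (hP : ∀ n : ℕ, 2 ≤ n → ComponentPackagePort n) (h1 : FaceFormCutClasses.OrderOneContact) : DeepGenericRung :=
  Leaf.genericRung_of_componentPort (L := deepLeaf) hV hD hU hR hN
    (fun _ hn => isExitPt_of_deepLeaf hM hC hGE hSE hCE hJE hΓE hXE hDXE hNE hn) hP h1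

/-! ### §Y.7  EXACT RE-LOCATIONS (the residual shrinks; equivalent modulo the deep decided half) -/

/-- **REFINEMENT EDGE (hypothesis-free)**: g20's residual implies g21's — `Cross.CrossSpecialRung → DeepSpecialRung`
(WEAKER BY LETTER).
[folklore] -/
theorem deepSpecialRung_of_crossSpecialRung (h : Cross.CrossSpecialRung) : DeepSpecialRung :=
  Leaf.specialRung_mono crossLeaf_le_deepLeaf (Cross.crossSpecialRung_iff.mp h)

/-- The deep decided half contains g20's: `DeepGenericRung → Cross.CrossGenericRung`. [folklore] -/
theorem crossGenericRung_of_deepGenericRung (h : DeepGenericRung) : Cross.CrossGenericRung :=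
  Cross.crossGenericRung_iff.mpr (Leaf.genericRung_anti crossLeaf_le_deepLeaf h)

end Kernels

end Deep

end Summit.ResolutionOfSingularities.ResolutionOfSingularities.Theorems.DeepCrossCut
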